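import Mathlib
import HarnessLib
import Literature.Probability.MarkovChains.DistinguishingStatisticSharp
import Literature.Probability.MarkovChains.RelaxationTimeLowerBound

/-!
# Wilson's method for lower bounds: `t_mix(ε) ≥ (1/(2 log(1/λ)))·[log((1−λ)Φ(x)²/(2R)) + log((1−ε)/ε)]` (Levin–Peres–Wilmer Theorem 13.28)

HONEST FRAMING: exact (Metropolis-corrected) sampling algorithms for lattice gauge theory; figures
of merit are autocorrelation/cost numbers at stated couplings and volumes; no continuum-physics claim.

Finite state space `X`, kernels `P : X → X → ℝ`, laws as vectors; `lawAt P (Pi.single x 1) t =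
Pᵗ(x,·)`, `tvDist`, `IsStationary` (`TotalVariation.lean`), `worstTvDist P π t = d(t)`, `mixingTime P π ε
= t_mix(ε)` (`BottleneckRatio.lean`), `lawMean` / `lawVariance` (`DistinguishingStatistic.lean`), the
eigenfunction lemmas of `RelaxationTimeLowerBound.lean` (Lemma 12.3 `E_π f = 0`, `Pᵗf = λᵗf`), and
Proposition 7.12 in the division-free form `sq_sub_lawMean_le_mul_tvDist` of
`DistinguishingStatisticSharp.lean`.  Source: D. A. Levin, Y. Peres (with E. L. Wilmer), *Markov
Chains and Mixing Times*, 2nd ed., AMS 2017 [LevinPeres2017], §13.5 "Wilson's method for lower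
bounds" (D. B. Wilson, Ann. Appl. Probab. 14 (2004)).  Everything is PROVED (finite sums; 0 named facts).

Setting: `P` row-stochastic with stationary probability vector `π`; `Φ : X → ℝ` an eigenfunction of
`P` with real eigenvalue `λ` (`Σ_y P(x,y)Φ(y) = λΦ(x)`), `1/2 < λ < 1`; `R > 0` with
`E_x|Φ(X₁) − Φ(x)|² = Σ_y P(x,y)[Φ(y) − Φ(x)]² ≤ R` for all `x` (13.27).

* `sum_mul_sq_le_of_eigenfunction` — `E(Φ(X_{t+1})² | X_t = z) ≤ (2λ − 1)Φ(z)² + R`;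
  `sum_stepLaw_mul_sq_le` — "averaging over the possible values of `z`": `E_μP Φ² ≤ (2λ−1)E_μ Φ² + R`
  [cite: LevinPeres2017, §13.5, proof of Thm 13.28 (the display ending "`≤ (2λ − 1)Φ(z)² + R`" and
  the next one)];
* **(13.31)** `LevinPeres2017_eq_13_31`: `E_x Φ(X_t) = λᵗΦ(x)`; **(13.32)** `LevinPeres2017_eq_13_32`:
  `E_x Φ(X_t)² ≤ (2λ−1)ᵗΦ(x)² + R/(2(1−λ))` (general initial law: `sum_lawAt_mul_sq_le`); **(13.33)**
  `LevinPeres2017_eq_13_33`: `Var_x Φ(X_t) ≤ R/(2(1−λ))` ("since `2λ − 1 < λ²`")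
  [cite: LevinPeres2017, §13.5 eqs. (13.31)–(13.33)];
* `lawMean_eigenfunction_eq_zero` (Lemma 12.3: `E_π Φ = 0`) and `lawVariance_eigenfunction_le`:
  **`Var_π(Φ) ≤ R/(2(1−λ))`** [cite: LevinPeres2017, §13.5, proof of Thm 13.28 ("Lemma 12.3 implies
  that `E_π(Φ) = 0` … `Var_π(Φ) ≤ R/(2(1−λ))`")].  DECLARED DEVIATION: the book obtains the last bound
  by letting `t → ∞` in (13.33) via the Convergence Theorem (Theorem 4.9, irreducible aperiodic
  chains); here it follows in one line from STATIONARITY — `E_π Φ(X₁)² = E_π Φ²` and the averaged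
  one-step bound give `E_π Φ² ≤ (2λ−1)E_π Φ² + R` — so irreducibility/aperiodicity are not needed for
  it (they enter the printed theorem only here and through the existence of `t_mix(ε)`, which is the
  hypothesis `∃ t, d(t) ≤ ε` below, as in `RelaxationTimeLowerBound.lean`);
* **(13.34)** `LevinPeres2017_eq_13_34`: `‖Pᵗ(x,·) − π‖_TV ≥ (1−λ)λ^{2t}Φ(x)² / (2R + (1−λ)λ^{2t}Φ(x)²)`
  (Proposition 7.12 with `r² = 2(1−λ)λ^{2t}Φ(x)²/R`); **(13.35)** `LevinPeres2017_eq_13_35`: if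
  `(1−λ)λ^{2t}Φ(x)² > 2Rε/(1−ε)` then `‖Pᵗ(x,·) − π‖_TV > ε`, "whence `d(t) > ε`"
  [cite: LevinPeres2017, §13.5 eqs. (13.34)–(13.35)];
* **THEOREM 13.28 (Wilson's method)** `LevinPeres2017_thm_13_28`: for `0 < ε < 1` and any `x` with
  `Φ(x) ≠ 0`, **`t_mix(ε) ≥ (1/(2 log(1/λ)))·[log((1−λ)Φ(x)²/(2R)) + log((1−ε)/ε)]`** (13.28), typed as
  `bound ≤ (mixingTime P π ε : ℝ)` for a chain that is `ε`-close at some time; the time-wise forms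
  `LevinPeres2017_thm_13_28_tv` / `_worstTvDist`: every `t` below the bound (13.36) has
  `‖Pᵗ(x,·) − π‖_TV > ε` and `d(t) > ε` [cite: LevinPeres2017, §13.5 Thm 13.28 eq. (13.27)–(13.28),
  proof eq. (13.36)].  SCOPE made explicit: `Φ(x) ≠ 0` (for `Φ(x) = 0` the printed bound is
  `log 0 = −∞`, vacuous; Lean's `Real.log 0 = 0` would not be); "irreducible aperiodic" replaced by
  the stationarity of `π` plus `∃ t, d(t) ≤ ε` as explained above.

Context (cell pub-lqcd, venture LatticeQCDFlow): Wilson's lemma turns ONE slowly-decorrelating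
observable (an approximate eigenfunction, e.g. a topological or magnetisation-like mode with
`E[Φ(X₁)|X₀] = λΦ(X₀)`) into a rigorous mixing-time LOWER bound `≈ t_rel·log(Φ(x)²(1−λ)/R)`;
companion of Theorems 7.4, 12.5 and Propositions 7.9 / 7.12 among the typed lower bounds.
-/

namespace Literature.Probability.MarkovChains

open Finset

variable {X : Type*} [Fintype X] [DecidableEq X]

/-! ## The one-step second-moment bound and its iteration -/

omit [DecidableEq X] in
/-- `Σ_y (μP)(y) g(y) = Σ_x μ(x) Σ_y P(x,y) g(y)`. [folklore] -/
private theorem sum_stepLaw_mul (P : X → X → ℝ) (μ g : X → ℝ) :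
    ∑ y, stepLaw P μ y * g y = ∑ x, μ x * ∑ y, P x y * g y := by
  unfold stepLaw
  calc ∑ y, (∑ x, μ x * P x y) * g y = ∑ y, ∑ x, μ x * P x y * g y := by simp_rw [sum_mul]
    _ = ∑ x, ∑ y, μ x * P x y * g y := Finset.sum_comm
    _ = ∑ x, μ x * ∑ y, P x y * g y := by simp_rw [mul_sum, mul_assoc]

/-- `Σ_y δ_x(y) g(y) = g(x)`. [folklore] -/
private theorem sum_single_mul (x : X) (g : X → ℝ) :
    ∑ y, (Pi.single x (1 : ℝ) : X → ℝ) y * g y = g x := by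
  rw [Finset.sum_eq_single x (fun y _ hy => by rw [Pi.single_apply, if_neg hy, zero_mul])
    (fun h => absurd (mem_univ x) h)]
  simp

omit [Fintype X] in
/-- `δ_x ≥ 0`. [folklore] -/
private theorem single_nonneg (x z : X) : 0 ≤ (Pi.single x (1 : ℝ) : X → ℝ) z := by
  rw [Pi.single_apply]; split_ifs <;> norm_num

/-- `Σ δ_x Pᵗ = 1`. [folklore] -/
private theorem sum_lawAt_single {P : X → X → ℝ} (hP : IsRowStochastic P) (x : X) (t : ℕ) :
    ∑ z, lawAt P (Pi.single x 1) t z = 1 := by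
  rw [sum_lawAt hP, Finset.sum_pi_single']; simp

omit [DecidableEq X] in
/-- The conditional one-step bound: for an eigenfunction `Φ` (`PΦ = λΦ`) with
`Σ_y P(z,y)[Φ(y) − Φ(z)]² ≤ R`, **`E(Φ(X_{t+1})² | X_t = z) = Σ_y P(z,y)Φ(y)² ≤ (2λ − 1)Φ(z)² + R`**
("`= Φ(z)² + 2E(D_tΦ(z) | X_t = z) + E(D_t² | X_t = z)`" with `E(D_t | X_t = z) = (λ − 1)Φ(z)`).
[cite: LevinPeres2017, §13.5, proof of Thm 13.28 (display ending "`≤ (2λ − 1)Φ(z)² + R`")] -/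
theorem sum_mul_sq_le_of_eigenfunction {P : X → X → ℝ} (hP : IsRowStochastic P) {Φ : X → ℝ}
    {lam : ℝ} (hΦ : ∀ x, ∑ y, P x y * Φ y = lam * Φ x) {R : ℝ}
    (hR : ∀ x, ∑ y, P x y * (Φ y - Φ x) ^ 2 ≤ R) (z : X) :
    ∑ y, P z y * Φ y ^ 2 ≤ (2 * lam - 1) * Φ z ^ 2 + R := by
  have hterm : ∀ y, P z y * Φ y ^ 2 = Φ z ^ 2 * P z y + 2 * Φ z * (P z y * Φ y)
      - 2 * Φ z ^ 2 * P z y + P z y * (Φ y - Φ z) ^ 2 := by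
    intro y; ring
  have hsum : ∑ y, P z y * Φ y ^ 2 = (2 * lam - 1) * Φ z ^ 2 + ∑ y, P z y * (Φ y - Φ z) ^ 2 := by
    simp_rw [hterm]
    rw [sum_add_distrib, sum_sub_distrib, sum_add_distrib, ← mul_sum, ← mul_sum, ← mul_sum,
      hP.2 z, hΦ z]
    ring
  rw [hsum]
  linarith [hR z]

omit [DecidableEq X] in
/-- "Averaging over the possible values of `z ∈ X` with weights `Pᵗ(x,z)`" — for any probability
vector `μ`: **`E_{μP} Φ² ≤ (2λ − 1)·E_μ Φ² + R`**. [cite: LevinPeres2017, §13.5, proof of Thm 13.28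
(display "`E_xΦ(X_{t+1})² ≤ (2λ − 1)E_xΦ(X_t)² + R`")] -/
theorem sum_stepLaw_mul_sq_le {P : X → X → ℝ} (hP : IsRowStochastic P) {Φ : X → ℝ} {lam : ℝ}
    (hΦ : ∀ x, ∑ y, P x y * Φ y = lam * Φ x) {R : ℝ} (hR : ∀ x, ∑ y, P x y * (Φ y - Φ x) ^ 2 ≤ R)
    {μ : X → ℝ} (hμ0 : ∀ x, 0 ≤ μ x) (hμ1 : ∑ x, μ x = 1) :
    ∑ y, stepLaw P μ y * Φ y ^ 2 ≤ (2 * lam - 1) * ∑ x, μ x * Φ x ^ 2 + R := by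
  rw [sum_stepLaw_mul]
  calc ∑ x, μ x * ∑ y, P x y * Φ y ^ 2 ≤ ∑ x, μ x * ((2 * lam - 1) * Φ x ^ 2 + R) :=
        sum_le_sum fun x _ =>
          mul_le_mul_of_nonneg_left (sum_mul_sq_le_of_eigenfunction hP hΦ hR x) (hμ0 x)
    _ = (2 * lam - 1) * ∑ x, μ x * Φ x ^ 2 + R * ∑ x, μ x := by
        rw [mul_sum, mul_sum, ← sum_add_distrib]
        exact sum_congr rfl fun x _ => by ring
    _ = (2 * lam - 1) * ∑ x, μ x * Φ x ^ 2 + R := by rw [hμ1, mul_one]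

omit [DecidableEq X] in
/-- Iterating the averaged bound ("apply this estimate inductively, then sum the resulting geometric
series"): for `1/2 ≤ λ < 1`, `R ≥ 0` and a probability vector `μ`,
`E_{μPᵗ} Φ² ≤ (2λ − 1)ᵗ·E_μ Φ² + R/(2(1 − λ))`. [cite: LevinPeres2017, §13.5, proof of Thm 13.28,
eq. (13.32) (for a general initial law)] -/
theorem sum_lawAt_mul_sq_le {P : X → X → ℝ} (hP : IsRowStochastic P) {Φ : X → ℝ} {lam : ℝ}
    (hΦ : ∀ x, ∑ y, P x y * Φ y = lam * Φ x) (hlam : 1 / 2 ≤ lam) (hlam1 : lam < 1) {R : ℝ}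
    (hR0 : 0 ≤ R) (hR : ∀ x, ∑ y, P x y * (Φ y - Φ x) ^ 2 ≤ R) {μ : X → ℝ} (hμ0 : ∀ x, 0 ≤ μ x)
    (hμ1 : ∑ x, μ x = 1) (t : ℕ) :
    ∑ y, lawAt P μ t y * Φ y ^ 2 ≤ (2 * lam - 1) ^ t * ∑ y, μ y * Φ y ^ 2 + R / (2 * (1 - lam)) := by
  have h1l : 0 < 1 - lam := by linarith
  have hC0 : 0 ≤ R / (2 * (1 - lam)) := div_nonneg hR0 (by linarith)
  induction t with
  | zero =>
    simp only [lawAt_zero, pow_zero, one_mul]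
    linarith
  | succ t ih =>
    rw [lawAt_succ]
    have hstep := sum_stepLaw_mul_sq_le hP hΦ hR (fun y => lawAt_nonneg hP hμ0 t y)
      (by rw [sum_lawAt hP, hμ1])
    have h2l : 0 ≤ 2 * lam - 1 := by linarith
    have h1l0 : (1 - lam) ≠ 0 := h1l.ne'
    calc ∑ y, stepLaw P (lawAt P μ t) y * Φ y ^ 2
        ≤ (2 * lam - 1) * ∑ y, lawAt P μ t y * Φ y ^ 2 + R := hstep
      _ ≤ (2 * lam - 1) * ((2 * lam - 1) ^ t * ∑ y, μ y * Φ y ^ 2 + R / (2 * (1 - lam))) + R := by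
          have := mul_le_mul_of_nonneg_left ih h2l
          linarith
      _ = (2 * lam - 1) ^ (t + 1) * ∑ y, μ y * Φ y ^ 2 + R / (2 * (1 - lam)) := by
          field_simp
          ring

/-! ## (13.31)–(13.33): mean and variance of `Φ(X_t)` started from `x` -/

/-- **(13.31)**: `E_x Φ(X_t) = λᵗ Φ(x)` ("by induction" from (13.30) `E(Φ(X_{t+1}) | X_t = z) = λΦ(z)`).
[cite: LevinPeres2017, §13.5 eq. (13.30)–(13.31)] -/
theorem LevinPeres2017_eq_13_31 {P : X → X → ℝ} {Φ : X → ℝ} {lam : ℝ}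
    (hΦ : ∀ x, ∑ y, P x y * Φ y = lam * Φ x) (x : X) (t : ℕ) :
    lawMean (lawAt P (Pi.single x 1) t) Φ = lam ^ t * Φ x := by
  -- the real eigenpair as a complex one, and `RelaxationTimeLowerBound.sum_kernel_mul_eigenfunction`
  have hC : ∀ z, ∑ y, (P z y : ℂ) * (Φ y : ℂ) = (lam : ℂ) * (Φ z : ℂ) := by
    intro z
    have := congrArg (fun r : ℝ => (r : ℂ)) (hΦ z)
    push_cast at this
    exact this
  have h := sum_kernel_mul_eigenfunction hC t x
  have h' : ((∑ y, lawAt P (Pi.single x 1) t y * Φ y : ℝ) : ℂ) = ((lam ^ t * Φ x : ℝ) : ℂ) := by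
    push_cast
    exact h
  unfold lawMean
  exact_mod_cast h'

/-- **(13.32)**: `E_x Φ(X_t)² ≤ (2λ − 1)ᵗ Φ(x)² + R/(2(1 − λ))` (for `1/2 ≤ λ < 1`, `R ≥ 0`).
[cite: LevinPeres2017, §13.5 eq. (13.32)] -/
theorem LevinPeres2017_eq_13_32 {P : X → X → ℝ} (hP : IsRowStochastic P) {Φ : X → ℝ} {lam : ℝ}
    (hΦ : ∀ x, ∑ y, P x y * Φ y = lam * Φ x) (hlam : 1 / 2 ≤ lam) (hlam1 : lam < 1) {R : ℝ}
    (hR0 : 0 ≤ R) (hR : ∀ x, ∑ y, P x y * (Φ y - Φ x) ^ 2 ≤ R) (x : X) (t : ℕ) :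
    ∑ y, lawAt P (Pi.single x 1) t y * Φ y ^ 2 ≤ (2 * lam - 1) ^ t * Φ x ^ 2 + R / (2 * (1 - lam)) := by
  have h := sum_lawAt_mul_sq_le hP hΦ hlam hlam1 hR0 hR (single_nonneg x)
    (by rw [Finset.sum_pi_single']; simp) t
  rwa [sum_single_mul] at h

/-- **(13.33)**: `Var_x Φ(X_t) ≤ [(2λ − 1)ᵗ − λ^{2t}]Φ(x)² + R/(2(1 − λ)) ≤ R/(2(1 − λ))`, "since
`2λ − 1 < λ²` ensures the first term is negative" (here: non-positive).
[cite: LevinPeres2017, §13.5 eq. (13.33)] -/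
theorem LevinPeres2017_eq_13_33 {P : X → X → ℝ} (hP : IsRowStochastic P) {Φ : X → ℝ} {lam : ℝ}
    (hΦ : ∀ x, ∑ y, P x y * Φ y = lam * Φ x) (hlam : 1 / 2 ≤ lam) (hlam1 : lam < 1) {R : ℝ}
    (hR0 : 0 ≤ R) (hR : ∀ x, ∑ y, P x y * (Φ y - Φ x) ^ 2 ≤ R) (x : X) (t : ℕ) :
    lawVariance (lawAt P (Pi.single x 1) t) Φ ≤ R / (2 * (1 - lam)) := by
  have h32 := LevinPeres2017_eq_13_32 hP hΦ hlam hlam1 hR0 hR x t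
  have hmean := LevinPeres2017_eq_13_31 hΦ x t (P := P)
  have hmom := sum_mul_sq_eq_lawVariance_add_sq (sum_lawAt_single hP x t) Φ
  rw [hmean] at hmom
  -- `(2λ − 1)ᵗ ≤ λ^{2t} = (λᵗ)²` since `0 ≤ 2λ − 1 ≤ λ²`
  have hpow : (2 * lam - 1) ^ t ≤ (lam ^ t) ^ 2 := by
    have h2 : (lam ^ t) ^ 2 = (lam ^ 2) ^ t := by rw [← pow_mul, ← pow_mul, Nat.mul_comm]
    rw [h2]
    exact pow_le_pow_left₀ (by linarith) (by nlinarith [sq_nonneg (lam - 1)]) t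
  nlinarith [h32, hpow, sq_nonneg (Φ x), hmom]

/-! ## `E_π Φ = 0` and `Var_π Φ ≤ R/(2(1−λ))` -/

omit [DecidableEq X] in
/-- Lemma 12.3 for a real eigenpair: `E_π(Φ) = 0` when `PΦ = λΦ`, `λ ≠ 1` and `πP = π`.
[cite: LevinPeres2017, §13.5, proof of Thm 13.28 ("Lemma 12.3 implies that `E_π(Φ) = 0`")] -/
theorem lawMean_eigenfunction_eq_zero {P : X → X → ℝ} {π : X → ℝ} (hst : IsStationary π P)
    {Φ : X → ℝ} {lam : ℝ} (hΦ : ∀ x, ∑ y, P x y * Φ y = lam * Φ x) (hlam1 : lam ≠ 1) :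
    lawMean π Φ = 0 := by
  classical
  have hC : ∀ z, ∑ y, (P z y : ℂ) * (Φ y : ℂ) = (lam : ℂ) * (Φ z : ℂ) := by
    intro z
    have := congrArg (fun r : ℝ => (r : ℂ)) (hΦ z)
    push_cast at this
    exact this
  have hlamC : (lam : ℂ) ≠ 1 := fun h => hlam1 (by exact_mod_cast h)
  have h := sum_mul_eigenfunction_eq_zero hst hC hlamC
  have h' : ((∑ y, π y * Φ y : ℝ) : ℂ) = ((0 : ℝ) : ℂ) := by
    push_cast
    exact h
  unfold lawMean
  exact_mod_cast h'

omit [DecidableEq X] in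
/-- **`Var_π(Φ) ≤ R/(2(1 − λ))`** for a stationary probability vector `π`, an eigenfunction `Φ` with
eigenvalue `λ < 1` and `Σ_y P(x,y)[Φ(y) − Φ(x)]² ≤ R`.  (Book: "Letting `t → ∞` in (13.33), the
Convergence Theorem implies …"; here directly from `πP = π`: `E_π Φ² = E_{πP} Φ² ≤ (2λ−1)E_π Φ² + R`
and `E_π Φ = 0`.) [cite: LevinPeres2017, §13.5, proof of Thm 13.28 (display
"`Var_π(Φ) ≤ R/(2(1−λ))`")] -/
theorem lawVariance_eigenfunction_le {P : X → X → ℝ} (hP : IsRowStochastic P) {π : X → ℝ}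
    (hπ0 : ∀ x, 0 ≤ π x) (hπ1 : ∑ x, π x = 1) (hst : IsStationary π P) {Φ : X → ℝ} {lam : ℝ}
    (hΦ : ∀ x, ∑ y, P x y * Φ y = lam * Φ x) (hlam1 : lam < 1) {R : ℝ}
    (hR : ∀ x, ∑ y, P x y * (Φ y - Φ x) ^ 2 ≤ R) :
    lawVariance π Φ ≤ R / (2 * (1 - lam)) := by
  have hstep := sum_stepLaw_mul_sq_le hP hΦ hR hπ0 hπ1
  rw [stepLaw_eq_self_of_isStationary hst] at hstep
  have hmom := sum_mul_sq_eq_lawVariance_add_sq hπ1 Φ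
  rw [lawMean_eigenfunction_eq_zero hst hΦ hlam1.ne] at hmom
  rw [le_div_iff₀ (by linarith)]
  nlinarith [hstep, hmom]

/-! ## (13.34)–(13.35) and Theorem 13.28 -/

/-- **(13.34)**: `‖Pᵗ(x,·) − π‖_TV ≥ (1 − λ)λ^{2t}Φ(x)² / (2R + (1 − λ)λ^{2t}Φ(x)²)` — Proposition 7.12
with `r² = 2(1 − λ)λ^{2t}Φ(x)²/R` (`|E_xΦ(X_t) − E_πΦ| = λᵗ|Φ(x)|`, `σ² ≤ R/(2(1−λ))`).  Hypotheses:
`P` row-stochastic, `π` a stationary probability vector, `PΦ = λΦ` with `1/2 ≤ λ < 1`, `R > 0` as in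
(13.27). [cite: LevinPeres2017, §13.5 eq. (13.34)] -/
theorem LevinPeres2017_eq_13_34 {P : X → X → ℝ} (hP : IsRowStochastic P) {π : X → ℝ}
    (hπ0 : ∀ x, 0 ≤ π x) (hπ1 : ∑ x, π x = 1) (hst : IsStationary π P) {Φ : X → ℝ} {lam : ℝ}
    (hΦ : ∀ x, ∑ y, P x y * Φ y = lam * Φ x) (hlam : 1 / 2 ≤ lam) (hlam1 : lam < 1) {R : ℝ}
    (hRpos : 0 < R) (hR : ∀ x, ∑ y, P x y * (Φ y - Φ x) ^ 2 ≤ R) (x : X) (t : ℕ) :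
    (1 - lam) * (lam ^ (2 * t) * Φ x ^ 2) / (2 * R + (1 - lam) * (lam ^ (2 * t) * Φ x ^ 2)) ≤
      tvDist (lawAt P (Pi.single x 1) t) π := by
  have h1l : 0 < 1 - lam := by linarith
  have h1l0 : (1 - lam) ≠ 0 := h1l.ne'
  have hD : lam ^ (2 * t) * Φ x ^ 2 = (lam ^ t * Φ x) ^ 2 := by rw [mul_pow, pow_mul']
  -- the two variances: (13.33) and the stationary bound
  have hV1 := LevinPeres2017_eq_13_33 hP hΦ hlam hlam1 hRpos.le hR x t
  have hV2 := lawVariance_eigenfunction_le hP hπ0 hπ1 hst hΦ hlam1 hR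
  have hV : lawVariance (lawAt P (Pi.single x 1) t) Φ + lawVariance π Φ ≤ R / (1 - lam) := by
    have : R / (2 * (1 - lam)) + R / (2 * (1 - lam)) = R / (1 - lam) := by field_simp; ring
    linarith
  -- Proposition 7.12, division-free core, with `Δ = λᵗΦ(x)`
  have key := sq_sub_lawMean_le_mul_tvDist (fun z => lawAt_nonneg hP (single_nonneg x) t z)
    (sum_lawAt_single hP x t) hπ0 hπ1 Φ
  rw [LevinPeres2017_eq_13_31 hΦ x t, lawMean_eigenfunction_eq_zero hst hΦ hlam1.ne, sub_zero,
    ← hD] at key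
  set D : ℝ := lam ^ (2 * t) * Φ x ^ 2 with hDdef
  set T : ℝ := tvDist (lawAt P (Pi.single x 1) t) π with hTdef
  have hT0 : 0 ≤ T := tvDist_nonneg _ _
  have hD0 : 0 ≤ D := by rw [hDdef]; positivity
  -- `D ≤ (2R/(1−λ) + D)·T`
  have key2 : D ≤ (2 * (R / (1 - lam)) + D) * T :=
    key.trans (mul_le_mul_of_nonneg_right (by linarith) hT0)
  have hden : 0 < 2 * R + (1 - lam) * D := by positivity
  rw [div_le_iff₀ hden]
  have := mul_le_mul_of_nonneg_left key2 h1l.le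
  have hRR : (1 - lam) * (R / (1 - lam)) = R := by field_simp
  calc (1 - lam) * D ≤ (1 - lam) * ((2 * (R / (1 - lam)) + D) * T) := this
    _ = T * (2 * R + (1 - lam) * D) := by linear_combination (2 * T) * hRR

/-- **(13.35)**: if `(1 − λ)λ^{2t}Φ(x)² > (ε/(1 − ε))·2R` (written `2Rε < (1 − λ)λ^{2t}Φ(x)²(1 − ε)`,
`ε < 1`), "then the right-hand side of (13.34) is strictly greater than `ε`, whence `d(t) > ε`":
`‖Pᵗ(x,·) − π‖_TV > ε`. [cite: LevinPeres2017, §13.5 eq. (13.35)] -/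
theorem LevinPeres2017_eq_13_35 {P : X → X → ℝ} (hP : IsRowStochastic P) {π : X → ℝ}
    (hπ0 : ∀ x, 0 ≤ π x) (hπ1 : ∑ x, π x = 1) (hst : IsStationary π P) {Φ : X → ℝ} {lam : ℝ}
    (hΦ : ∀ x, ∑ y, P x y * Φ y = lam * Φ x) (hlam : 1 / 2 ≤ lam) (hlam1 : lam < 1) {R : ℝ}
    (hRpos : 0 < R) (hR : ∀ x, ∑ y, P x y * (Φ y - Φ x) ^ 2 ≤ R) (x : X) (t : ℕ) {ε : ℝ}
    (h35 : 2 * R * ε < (1 - lam) * (lam ^ (2 * t) * Φ x ^ 2) * (1 - ε)) :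
    ε < tvDist (lawAt P (Pi.single x 1) t) π := by
  have h34 := LevinPeres2017_eq_13_34 hP hπ0 hπ1 hst hΦ hlam hlam1 hRpos hR x t
  set a : ℝ := (1 - lam) * (lam ^ (2 * t) * Φ x ^ 2) with ha
  have ha0 : 0 ≤ a := by
    rw [ha]; exact mul_nonneg (by linarith) (by positivity)
  have hden : 0 < 2 * R + a := by positivity
  have hlt : ε < a / (2 * R + a) := by
    rw [lt_div_iff₀ hden]
    have : a * (1 - ε) = a - a * ε := by ring
    linarith
  exact hlt.trans_le h34

/-- **Theorem 13.28, time-wise form**: under the hypotheses of Wilson's method (row-stochastic `P`,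
stationary probability vector `π`, `PΦ = λΦ` with `1/2 < λ < 1`, (13.27) with `R > 0`, `0 < ε < 1`,
and a state `x` with `Φ(x) ≠ 0`), EVERY `t` below the bound (13.36),
`t < (1/(2 log(1/λ)))·[log((1−λ)Φ(x)²/(2R)) + log((1−ε)/ε)]`, has `‖Pᵗ(x,·) − π‖_TV > ε`.
[cite: LevinPeres2017, §13.5 Thm 13.28, proof eq. (13.36) ("the inequality (13.35) holds, so
`t_mix(ε) > t`")] -/
theorem LevinPeres2017_thm_13_28_tv {P : X → X → ℝ} (hP : IsRowStochastic P) {π : X → ℝ}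
    (hπ0 : ∀ x, 0 ≤ π x) (hπ1 : ∑ x, π x = 1) (hst : IsStationary π P) {Φ : X → ℝ} {lam : ℝ}
    (hΦ : ∀ x, ∑ y, P x y * Φ y = lam * Φ x) (hlam : 1 / 2 < lam) (hlam1 : lam < 1) {R : ℝ}
    (hRpos : 0 < R) (hR : ∀ x, ∑ y, P x y * (Φ y - Φ x) ^ 2 ≤ R) {ε : ℝ} (hε : 0 < ε)
    (hε1 : ε < 1) {x : X} (hx : Φ x ≠ 0) {t : ℕ}
    (ht : (t : ℝ) < 1 / (2 * Real.log (1 / lam)) *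
      (Real.log ((1 - lam) * Φ x ^ 2 / (2 * R)) + Real.log ((1 - ε) / ε))) :
    ε < tvDist (lawAt P (Pi.single x 1) t) π := by
  refine LevinPeres2017_eq_13_35 hP hπ0 hπ1 hst hΦ hlam.le hlam1 hRpos hR x t ?_
  have hlam0 : 0 < lam := by linarith
  have h1l : 0 < 1 - lam := by linarith
  have hΦ2 : 0 < Φ x ^ 2 := lt_of_le_of_ne (sq_nonneg _) (Ne.symm (pow_ne_zero 2 hx))
  have ha0 : 0 < (1 - lam) * Φ x ^ 2 / (2 * R) := by positivity
  have hb : 0 < (1 - ε) / ε := div_pos (by linarith) hε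
  -- `L = log(1/λ) > 0` and `2Lt < log a₀ + log b`
  have hL : 0 < Real.log (1 / lam) := Real.log_pos (by
    rw [lt_div_iff₀ hlam0, one_mul]; exact hlam1)
  have h2L : 0 < 2 * Real.log (1 / lam) := by positivity
  have h1 : 2 * Real.log (1 / lam) * t <
      Real.log ((1 - lam) * Φ x ^ 2 / (2 * R)) + Real.log ((1 - ε) / ε) := by
    rw [one_div_mul_eq_div, lt_div_iff₀ h2L] at ht
    linarith
  -- `log(λ^{2t} · a₀ · b) = −2Lt + log a₀ + log b > 0`, hence `λ^{2t} a₀ b > 1`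
  have hlogl : Real.log (1 / lam) = -Real.log lam := by rw [one_div, Real.log_inv]
  have hprod : 0 < lam ^ (2 * t) * ((1 - lam) * Φ x ^ 2 / (2 * R)) * ((1 - ε) / ε) := by positivity
  have hlog : Real.log (lam ^ (2 * t) * ((1 - lam) * Φ x ^ 2 / (2 * R)) * ((1 - ε) / ε)) =
      (2 * t : ℝ) * Real.log lam + Real.log ((1 - lam) * Φ x ^ 2 / (2 * R)) +
        Real.log ((1 - ε) / ε) := by
    rw [Real.log_mul (by positivity) hb.ne', Real.log_mul (by positivity) ha0.ne', Real.log_pow]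
    push_cast
    ring
  have hpos : 0 < Real.log (lam ^ (2 * t) * ((1 - lam) * Φ x ^ 2 / (2 * R)) * ((1 - ε) / ε)) := by
    rw [hlog]
    rw [hlogl] at h1
    linarith
  have hgt : 1 < lam ^ (2 * t) * ((1 - lam) * Φ x ^ 2 / (2 * R)) * ((1 - ε) / ε) := by
    by_contra hle
    push Not at hle
    exact absurd (Real.log_nonpos hprod.le hle) (not_le.2 hpos)
  -- clear denominators: `2Rε < (1−λ)λ^{2t}Φ(x)²(1−ε)`
  have hR0 : R ≠ 0 := hRpos.ne'
  have hε0 : ε ≠ 0 := hε.ne'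
  have heq : lam ^ (2 * t) * ((1 - lam) * Φ x ^ 2 / (2 * R)) * ((1 - ε) / ε) =
      (1 - lam) * (lam ^ (2 * t) * Φ x ^ 2) * (1 - ε) / (2 * R * ε) := by
    field_simp
  have h2Rε : 0 < 2 * R * ε := by positivity
  rw [heq, lt_div_iff₀ h2Rε, one_mul] at hgt
  exact hgt

/-- **Theorem 13.28, form `d(t) > ε`** for every `t` below the bound (13.36).
[cite: LevinPeres2017, §13.5 Thm 13.28, proof ("whence, `d(t) > ε`")] -/
theorem LevinPeres2017_thm_13_28_worstTvDist {P : X → X → ℝ} (hP : IsRowStochastic P) {π : X → ℝ}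
    (hπ0 : ∀ x, 0 ≤ π x) (hπ1 : ∑ x, π x = 1) (hst : IsStationary π P) {Φ : X → ℝ} {lam : ℝ}
    (hΦ : ∀ x, ∑ y, P x y * Φ y = lam * Φ x) (hlam : 1 / 2 < lam) (hlam1 : lam < 1) {R : ℝ}
    (hRpos : 0 < R) (hR : ∀ x, ∑ y, P x y * (Φ y - Φ x) ^ 2 ≤ R) {ε : ℝ} (hε : 0 < ε)
    (hε1 : ε < 1) {x : X} (hx : Φ x ≠ 0) {t : ℕ}
    (ht : (t : ℝ) < 1 / (2 * Real.log (1 / lam)) *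
      (Real.log ((1 - lam) * Φ x ^ 2 / (2 * R)) + Real.log ((1 - ε) / ε))) :
    ε < worstTvDist P π t :=
  (LevinPeres2017_thm_13_28_tv hP hπ0 hπ1 hst hΦ hlam hlam1 hRpos hR hε hε1 hx ht).trans_le
    (tvDist_single_le_worstTvDist P π t x)

/-- **Theorem 13.28 (Wilson's method).**  Let `P` be a row-stochastic kernel on a finite `X` with
stationary probability vector `π`, `Φ` an eigenfunction of `P` with real eigenvalue `λ`,
`1/2 < λ < 1`, `0 < ε < 1`, and `R > 0` with `E_x|Φ(X₁) − Φ(x)|² ≤ R` for all `x` (13.27).  Then for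
any `x` with `Φ(x) ≠ 0`,
**`t_mix(ε) ≥ (1/(2 log(1/λ)))·[log((1 − λ)Φ(x)²/(2R)) + log((1 − ε)/ε)]`** (13.28) — for a chain
that is `ε`-close to `π` at some time (automatic for the book's irreducible aperiodic chains).
[cite: LevinPeres2017, §13.5 Thm 13.28 eq. (13.27)–(13.28)] -/
theorem LevinPeres2017_thm_13_28 {P : X → X → ℝ} (hP : IsRowStochastic P) {π : X → ℝ}
    (hπ0 : ∀ x, 0 ≤ π x) (hπ1 : ∑ x, π x = 1) (hst : IsStationary π P) {Φ : X → ℝ} {lam : ℝ}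
    (hΦ : ∀ x, ∑ y, P x y * Φ y = lam * Φ x) (hlam : 1 / 2 < lam) (hlam1 : lam < 1) {R : ℝ}
    (hRpos : 0 < R) (hR : ∀ x, ∑ y, P x y * (Φ y - Φ x) ^ 2 ≤ R) {ε : ℝ} (hε : 0 < ε)
    (hε1 : ε < 1) {x : X} (hx : Φ x ≠ 0) (hmix : ∃ t, worstTvDist P π t ≤ ε) :
    1 / (2 * Real.log (1 / lam)) *
        (Real.log ((1 - lam) * Φ x ^ 2 / (2 * R)) + Real.log ((1 - ε) / ε)) ≤
      (mixingTime P π ε : ℝ) := by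
  by_contra h
  push Not at h
  obtain ⟨t₀, ht₀⟩ := hmix
  have h1 := worstTvDist_mixingTime_le P π ht₀
  have h2 := LevinPeres2017_thm_13_28_worstTvDist hP hπ0 hπ1 hst hΦ hlam hlam1 hRpos hR hε hε1 hx h
  linarith

end Literature.Probability.MarkovChains
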